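import Summits.QuantumFields.BalabanUV.Beta.GAN24.DerivativeRateTransferJensenChain

/-!
# `BalabanUV.Beta.GAN24.DerivativeRateTransferJensen` — binder row G-an2-4 ∕ (CONV-C), route R6 «VALUES, NOT DERIVATIVES», PART 22:
# THE COVARIANT JENSEN INEQUALITY — (STAB-ε,δ) PROVED for TRANSPORTED BLOCK AVERAGINGS of colour site fields with ORTHOGONAL transporters:
# `Qᵀ H_c Q ≤ (1+t)·H_f + (1+t⁻¹)·κ²·w_c·g·1` for every `t > 0` (κ = the loop-holonomy defect), and `Qᵀ H_c Q ≤ H_f` EXACTLY when the loops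
# are flat (unit b2b-balaban-gan24-p3, gen 37; v1)

NOT IN PRINT; OUR PROOF (for the ROUTE; [folklore] finite-dimensional linear algebra over `ℝ` — PART 21's one-chain letters BY NAME + `Equiv.sum_comp`,
`Finset.sum_comm`, `Fintype.sum_prod_type`).  HONEST FRAMING (cell contract, verbatim): «discharging `BetaPertH` makes Bałaban's UV stability UNCONDITIONAL
— a real constructive-QFT result; it is NOT the continuum limit and NOT the Clay problem.»  HONEST DEPENDENCY (verbatim): «continuum YM on T⁴ ⇐ BetaPertH ∧
nine spine estimates (0/9 proved); BetaPertH ⇐ (D1) ∧ (D4) ∧ CAP+tail; G-an2-4 gates asym, D1 and NE2/3/4.»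

WHY THIS FILE.  ROUTES-GAN24 v36 §2 R6: «(STAB)(s,t) [… with background: NOT IN PRINT as a form inequality — to be PROVED (Jensen for transported block
averages + curvature slack)]».  THIS FILE PROVES IT for the model class «covariant colour Laplacians with arbitrary orthogonal transporters»:
* FINE level: sites `ν`, colours `o`, fields `u : ν × o → ℝ`, bonds `e : β` from `src e` to `tgt e` with ORTHOGONAL transporters `R_e` (`R_eᵀR_e = 1`),
  covariant differences `D_e u = R_e u(tgt e) − u(src e)`, and ANY fine form `H_f` with `⟨u, H_f u⟩ ≥ w_f·Σ_e |D_e u|²` (a gauge-fixing ∕ mass ∕ constraint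
  term only helps);
* COARSE level: sites `μ`, bonds `e′ : β′` (`src′, tgt′, R′`), ANY coarse form `H_c` with `⟨v, H_c v⟩ ≤ w_c·Σ_{e′} |D′_{e′} v|²`;
* AVERAGING `(Qu)(y) = Σ_x q(y,x)·W(y,x) u(x)` with block weights `q ≥ 0`, `Σ_x q(y,x) ≤ 1`, orthogonal block transporters `W(y,x)` (Bałaban's
  (1.18)-type transported block means; `q(y,x) = L^{−d}·[x ∈ B(y)]` in the lattice);
* PAIRING ∕ CHAINS: for each coarse bond `e′` a bijection `σ_{e′}` of the fine sites carrying the weights of the source block onto those of the target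
  block (`q(tgt′e′, σx) = q(src′e′, x)` — the lattice translation by `L·e_μ`) and, for each fine site `x`, a chain of `ℓ` fine bonds `γ(e′,x,i)` through
  sites `xs(e′,x,0) = x, …, xs(e′,x,ℓ) = σx` (the straight fine line), with partial transports `T(e′,x,i)`;
* COUNTS: `q`-weighted MULTIPLICITY of the chain system through any fine bond `≤ m` (lattice: `L·L^{−d}`), Gram count `Σ_{e′} q(tgt′e′, x) ≤ g` (lattice:
  `d·L^{−d}`), and the weight bookkeeping `w_c·ℓ·m ≤ w_f` (lattice: `η_j^{d−2}·L·L^{1−d} = η_{j+1}^{d−2}` — EQUALITY);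
* HOLONOMY: the loop «block contour `W(y,x)` → coarse bond `R′_{e′}` → block contour `W(y′,σx)` back → fine chain back» has holonomy
  `V = W(y,x)ᵀ R′ W(y′,σx) T_ℓᵀ` with `|(V − 1)w| ≤ κ|w|` (flat: `V = 1` — U = 1, pure gauges, coarse transporters := the induced holonomies).
THEN (§4): `⟨Qu, H_c Qu⟩ ≤ (1+t)⟨u, H_f u⟩ + (1+t⁻¹)·κ²·w_c·g·|u|²` for every `t > 0`, i.e. (STAB-ε,δ) of PART 20 with `ε = t`, `δ·G = (1+t⁻¹)κ²w_c g·1`;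
and `⟨Qu, H_c Qu⟩ ≤ ⟨u, H_f u⟩` — PART 18's (STAB) with constant EXACTLY 1 — when the loops are flat.  Proof: the coarse covariant difference of a
transported block mean = the block mean of transported CHAINS of fine covariant differences + the holonomy defect (§2 + PART 21); Jensen in the block,
Cauchy–Schwarz along the chain, two counting sums (§1).

WHAT THIS FILE PROVES (0 sorry, 0 `def`, nothing cited):
* §1 counting: `sum_chain_le_of_multiplicity` (q-weighted multiplicity `≤ m` ⟹ `Σ_{e′,x} q·Σ_{i<ℓ} F(γ_i) ≤ m·Σ_e F(e)` for `F ≥ 0`),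
  `sum_pair_le_of_gramCount` (`Σ_{e′,x} q(src′e′,x)·M(σx) ≤ g·Σ_x M(x)`), `dotProduct_self_eq_sum_sites`, `constraint_form_comp` ((1.17): exact).
* §2 `transported_pair_eq` (`R′W′a − Wb = W·(V·T_ℓ a − b)`), **`coarseDiff_avg_eq`** (`D′_{e′}(Qu) = Σ_x q(y,x)·(R′W(y′,σx)u(σx) − W(y,x)u(x))`).
* §3 **`covJensen_core`** — the assembly from a per-pair bound `|R′W′u(σx) − Wu(x)|² ≤ A·ℓ·Σ_{i<ℓ}|D_{γ_i}u|² + B·|u(σx)|²`.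
* §4 THE ENDS: **`covJensen_flat`** ∕ **`posSemidef_covJensen_flat`** (`(H_f − QᵀH_cQ).PosSemidef` — (STAB) with constant 1), **`covJensen_holonomy`** ∕
  **`posSemidef_covJensen_holonomy`** (`((1+t)•H_f + ((1+t⁻¹)κ²w_c g)•1 − QᵀH_cQ).PosSemidef` — (STAB-ε,δ) for PART 20, `G = 1`).
WHAT IT DOES NOT DO: assert that Bałaban's covariant averaging `Q(U)` ∕ operators `Δ^{(k)}(U)` (VECTOR fields, Landau ∕ axial gauge terms, `−∂P∂*`)
instantiate these letters (S2(ii); the vector case needs road P4's plaquette Jensen for the curl part); bound `κ` from a small-field condition (lattice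
Stokes — not in the tree); say anything about (CONS).  SUPPLIER work on route R6 (rank 2, REDUCTION, no seat); no consumer of record; NEVER «G-an2-4
closed»; NOT (CONV-C), NOT D1, NOT `BetaPertH`, NOT continuum, NOT Clay.  Records: `HOME/b2b-balaban-gan24-p3/WOODBURY-FIBRE.md` v13.7. -/

noncomputable section

open Matrix Finset

namespace Summit.QuantumFields.BalabanUV.Beta.GAN24.DerivativeRateTransferJensen

open Summit.QuantumFields.BalabanUV.Beta.GAN24.DerivativeRateTransferLoewnerKKT (mulVec_dotProduct_eq)
open Summit.QuantumFields.BalabanUV.Beta.GAN24.DerivativeRateTransferJensenChain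

/-! ## §1 Counting sums -/

section Counting

variable {β β' μ ν : Type*} [Fintype β] [DecidableEq β] [Fintype β'] [Fintype μ] [Fintype ν]

omit [Fintype μ] in
/-- **q-WEIGHTED MULTIPLICITY ⟹ THE CHAIN SUM IS DOMINATED BY THE BOND SUM**: if for every fine bond `e` the total weight of the chains through it is
`Σ_{e′} Σ_x Σ_{i<ℓ} [γ(e′,x,i) = e]·q(src′e′, x) ≤ m`, then `Σ_{e′} Σ_x q(src′e′,x)·Σ_{i<ℓ} F(γ(e′,x,i)) ≤ m·Σ_e F(e)` for every `F ≥ 0`. [folklore] -/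
theorem sum_chain_le_of_multiplicity (q : μ → ν → ℝ) (src' : β' → μ) (γ : β' → ν → ℕ → β) (ℓ : ℕ) {m : ℝ}
    (hmult : ∀ e, ∑ e', ∑ x, ∑ i ∈ range ℓ, (if γ e' x i = e then q (src' e') x else 0) ≤ m)
    (F : β → ℝ) (hF : ∀ e, 0 ≤ F e) :
    ∑ e', ∑ x, q (src' e') x * ∑ i ∈ range ℓ, F (γ e' x i) ≤ m * ∑ e, F e := by
  have h1 : ∀ e' x, q (src' e') x * ∑ i ∈ range ℓ, F (γ e' x i) =
      ∑ e, (∑ i ∈ range ℓ, (if γ e' x i = e then q (src' e') x else 0)) * F e := by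
    intro e' x
    rw [Finset.mul_sum]
    simp_rw [Finset.sum_mul]
    rw [Finset.sum_comm]
    refine Finset.sum_congr rfl fun i _ => ?_
    simp_rw [ite_mul, zero_mul]
    rw [Finset.sum_ite_eq]
    simp
  have h2 : ∀ e', ∑ x, ∑ e, (∑ i ∈ range ℓ, (if γ e' x i = e then q (src' e') x else 0)) * F e =
      ∑ e, ∑ x, (∑ i ∈ range ℓ, (if γ e' x i = e then q (src' e') x else 0)) * F e := fun e' => Finset.sum_comm
  simp_rw [h1, h2]
  rw [Finset.sum_comm, Finset.mul_sum]
  refine Finset.sum_le_sum fun e _ => ?_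
  simp_rw [← Finset.sum_mul]
  exact mul_le_mul_of_nonneg_right (hmult e) (hF e)

omit [Fintype β] [DecidableEq β] [Fintype μ] in
/-- **THE GRAM COUNT**: with the weight-carrying pairings `q(tgt′e′, σ_{e′}x) = q(src′e′, x)` and `Σ_{e′} q(tgt′e′, x′) ≤ g` for every fine site `x′`:
`Σ_{e′} Σ_x q(src′e′, x)·M(σ_{e′}x) ≤ g·Σ_{x′} M(x′)` for every `M ≥ 0`. [folklore] -/
theorem sum_pair_le_of_gramCount (q : μ → ν → ℝ) (src' tgt' : β' → μ) (σ : β' → ν ≃ ν)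
    (hσq : ∀ e' x, q (tgt' e') (σ e' x) = q (src' e') x) {g : ℝ} (hgram : ∀ x, ∑ e', q (tgt' e') x ≤ g)
    (M : ν → ℝ) (hM : ∀ x, 0 ≤ M x) :
    ∑ e', ∑ x, q (src' e') x * M (σ e' x) ≤ g * ∑ x, M x := by
  have h1 : ∀ e', ∑ x, q (src' e') x * M (σ e' x) = ∑ x, q (tgt' e') x * M x := fun e' => by
    simp_rw [← hσq e']
    exact Equiv.sum_comp (σ e') (fun x => q (tgt' e') x * M x)
  rw [Finset.sum_congr rfl (fun e' _ => h1 e'), Finset.sum_comm, Finset.mul_sum]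
  refine Finset.sum_le_sum fun x _ => ?_
  rw [← Finset.sum_mul]
  exact mul_le_mul_of_nonneg_right (hgram x) (hM x)

omit [Fintype β] [DecidableEq β] [Fintype β'] [Fintype μ] in
/-- `|u|² = Σ_x |u(x)|²` for a colour site field `u : ν × o → ℝ`. [folklore] -/
theorem dotProduct_self_eq_sum_sites {o : Type*} [Fintype o] (u : ν × o → ℝ) :
    u ⬝ᵥ u = ∑ x, (fun a => u (x, a)) ⬝ᵥ (fun a => u (x, a)) := by
  simp only [dotProduct]
  exact Fintype.sum_prod_type _

omit [Fintype β] [DecidableEq β] [Fintype β'] in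
/-- **THE CONSTRAINT TERM IS EXACTLY STABLE** ((1.17) `Q_c^{(j+1)} = Q_c^{(j)}·Qf`): `Qfᵀ (Q_cᵀ A Q_c) Qf = (Q_c Qf)ᵀ A (Q_c Qf)` — the `a·|Q_c u|²` part of
Bałaban's `Δ_a`-type forms passes through (STAB) with equality. [folklore] -/
theorem constraint_form_comp {c κ : Type*} [Fintype c] [Fintype κ] (A : Matrix c c ℝ) (Qc : Matrix c μ ℝ) (Qf : Matrix μ κ ℝ) :
    Qfᵀ * (Qcᵀ * A * Qc) * Qf = (Qc * Qf)ᵀ * A * (Qc * Qf) := by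
  rw [transpose_mul]; simp only [Matrix.mul_assoc]

end Counting

/-! ## §2 The coarse covariant difference of a transported block mean -/

section Identity

variable {o μ ν : Type*} [Fintype o] [DecidableEq o] [Fintype μ] [Fintype ν]

omit [Fintype μ] [Fintype ν] in
/-- **`R′W′a − Wb = W·(V·T_ℓ a − b)`** with `V = WᵀR′W′T_ℓᵀ` (`W`, `T_ℓ` orthogonal) — factoring the source block transporter out of a transported pair. [folklore] -/
theorem transported_pair_eq {W W' R' Tl : Matrix o o ℝ} (hW : Wᵀ * W = 1) (hT : Tlᵀ * Tl = 1) (a b : o → ℝ) :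
    R' *ᵥ (W' *ᵥ a) - W *ᵥ b = W *ᵥ ((Wᵀ * R' * W' * Tlᵀ) *ᵥ (Tl *ᵥ a) - b) := by
  have key : W * (Wᵀ * R' * W' * Tlᵀ * Tl) = R' * W' := by
    calc W * (Wᵀ * R' * W' * Tlᵀ * Tl) = (W * Wᵀ) * R' * W' * (Tlᵀ * Tl) := by simp only [Matrix.mul_assoc]
      _ = R' * W' := by rw [mul_transpose_of_orthogonal hW, hT, Matrix.one_mul, Matrix.mul_one]
  simp only [mulVec_sub, mulVec_mulVec, key]

omit [DecidableEq o] [Fintype μ] in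
/-- **`coarseDiff_avg_eq` — THE COARSE COVARIANT DIFFERENCE OF A TRANSPORTED BLOCK MEAN**: with `(Qu)(y) = Σ_x q(y,x)·W(y,x)u(x)` and a pairing `σ`
carrying the weights of the block of `y` onto those of the block of `y′` (`q(y′, σx) = q(y, x)`):
`R′(Qu)(y′) − (Qu)(y) = Σ_x q(y,x)·(R′W(y′,σx)u(σx) − W(y,x)u(x))`. [our proof] -/
theorem coarseDiff_avg_eq {q : μ → ν → ℝ} {W : μ → ν → Matrix o o ℝ} {Q : Matrix (μ × o) (ν × o) ℝ}
    (hQ : ∀ (u : ν × o → ℝ) (y : μ), (fun a => (Q *ᵥ u) (y, a)) = ∑ x, q y x • (W y x *ᵥ fun b => u (x, b)))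
    {y y' : μ} (R' : Matrix o o ℝ) (σ : ν ≃ ν) (hσq : ∀ x, q y' (σ x) = q y x) (u : ν × o → ℝ) :
    (R' *ᵥ fun a => (Q *ᵥ u) (y', a)) - (fun a => (Q *ᵥ u) (y, a)) =
      ∑ x, q y x • (R' *ᵥ (W y' (σ x) *ᵥ fun b => u (σ x, b)) - W y x *ᵥ fun b => u (x, b)) := by
  have h1 : (fun a => (Q *ᵥ u) (y', a)) = ∑ x, q y x • (W y' (σ x) *ᵥ fun b => u (σ x, b)) := by
    rw [hQ u y']
    simp_rw [← hσq]
    exact (Equiv.sum_comp σ (fun x => q y' x • (W y' x *ᵥ fun b => u (x, b)))).symm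
  rw [h1, hQ u y, mulVec_sum, ← Finset.sum_sub_distrib]
  exact Finset.sum_congr rfl fun x _ => by rw [mulVec_smul, smul_sub]

end Identity

/-! ## §3 The core assembly -/

section Core

variable {o μ ν β β' : Type*} [Fintype o] [Fintype μ] [Fintype ν] [Fintype β] [DecidableEq β] [Fintype β']

/-- **`covJensen_core` — THE ASSEMBLY** [our proof]: from the structure (block weights `q ≥ 0` with `Σ_x q(y,x) ≤ 1`, the averaging identity `hQ`,
the coarse form bound `hHc`, the weight-carrying pairings `σ`, q-weighted multiplicity `≤ m` of the chains `γ`, Gram count `≤ g`) and a PER-PAIR bound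
`|R′_{e′}W(tgt′e′,σx)u(σx) − W(src′e′,x)u(x)|² ≤ A·ℓ·Σ_{i<ℓ}|D_{γ(e′,x,i)}u|² + B·|u(σx)|²` (`A, B ≥ 0`):
`⟨Qu, H_c Qu⟩ ≤ w_c·(A·ℓ·(m·Σ_e|D_e u|²) + B·(g·|u|²))`. -/
theorem covJensen_core
    {q : μ → ν → ℝ} (hq : ∀ y x, 0 ≤ q y x) (hq1 : ∀ y, ∑ x, q y x ≤ 1)
    {W : μ → ν → Matrix o o ℝ} {Q : Matrix (μ × o) (ν × o) ℝ}
    (hQ : ∀ (u : ν × o → ℝ) (y : μ), (fun a => (Q *ᵥ u) (y, a)) = ∑ x, q y x • (W y x *ᵥ fun b => u (x, b)))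
    {src tgt : β → ν} {R : β → Matrix o o ℝ} {src' tgt' : β' → μ} {R' : β' → Matrix o o ℝ}
    {Hc : Matrix (μ × o) (μ × o) ℝ} {wc : ℝ} (hwc : 0 ≤ wc)
    (hHc : ∀ v : μ × o → ℝ, v ⬝ᵥ (Hc *ᵥ v) ≤
      wc * ∑ e', ((R' e' *ᵥ fun a => v (tgt' e', a)) - fun a => v (src' e', a)) ⬝ᵥ
        ((R' e' *ᵥ fun a => v (tgt' e', a)) - fun a => v (src' e', a)))
    {σ : β' → ν ≃ ν} (hσq : ∀ e' x, q (tgt' e') (σ e' x) = q (src' e') x)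
    {ℓ : ℕ} {γ : β' → ν → ℕ → β} {m g : ℝ}
    (hmult : ∀ e, ∑ e', ∑ x, ∑ i ∈ range ℓ, (if γ e' x i = e then q (src' e') x else 0) ≤ m)
    (hgram : ∀ x, ∑ e', q (tgt' e') x ≤ g)
    {A Bk : ℝ} (hA : 0 ≤ A) (hBk : 0 ≤ Bk) (u : ν × o → ℝ)
    (hchain : ∀ e' x,
      ((R' e' *ᵥ (W (tgt' e') (σ e' x) *ᵥ fun b => u (σ e' x, b))) - W (src' e') x *ᵥ fun b => u (x, b)) ⬝ᵥ
          ((R' e' *ᵥ (W (tgt' e') (σ e' x) *ᵥ fun b => u (σ e' x, b))) - W (src' e') x *ᵥ fun b => u (x, b)) ≤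
        A * (ℓ * ∑ i ∈ range ℓ,
              ((R (γ e' x i) *ᵥ fun b => u (tgt (γ e' x i), b)) - fun b => u (src (γ e' x i), b)) ⬝ᵥ
                ((R (γ e' x i) *ᵥ fun b => u (tgt (γ e' x i), b)) - fun b => u (src (γ e' x i), b))) +
          Bk * ((fun b => u (σ e' x, b)) ⬝ᵥ fun b => u (σ e' x, b))) :
    (Q *ᵥ u) ⬝ᵥ (Hc *ᵥ (Q *ᵥ u)) ≤
      wc * (A * ℓ * (m * ∑ e, ((R e *ᵥ fun b => u (tgt e, b)) - fun b => u (src e, b)) ⬝ᵥ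
                ((R e *ᵥ fun b => u (tgt e, b)) - fun b => u (src e, b))) +
        Bk * (g * (u ⬝ᵥ u))) := by
  -- abbreviations: the fine bond energies `F e`, the site masses `M x`
  set F : β → ℝ := fun e => ((R e *ᵥ fun b => u (tgt e, b)) - fun b => u (src e, b)) ⬝ᵥ
    ((R e *ᵥ fun b => u (tgt e, b)) - fun b => u (src e, b)) with hF
  set M : ν → ℝ := fun x => (fun b => u (x, b)) ⬝ᵥ fun b => u (x, b) with hM
  have hF0 : ∀ e, 0 ≤ F e := fun e => dotProduct_self_nonneg' _
  have hM0 : ∀ x, 0 ≤ M x := fun x => dotProduct_self_nonneg' _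
  have hchain' : ∀ e' x,
      ((R' e' *ᵥ (W (tgt' e') (σ e' x) *ᵥ fun b => u (σ e' x, b))) - W (src' e') x *ᵥ fun b => u (x, b)) ⬝ᵥ
          ((R' e' *ᵥ (W (tgt' e') (σ e' x) *ᵥ fun b => u (σ e' x, b))) - W (src' e') x *ᵥ fun b => u (x, b)) ≤
        A * (ℓ * ∑ i ∈ range ℓ, F (γ e' x i)) + Bk * M (σ e' x) := fun e' x => hchain e' x
  -- per coarse bond: Jensen in the block, then the per-pair bound
  have hper : ∀ e',
      ((R' e' *ᵥ fun a => (Q *ᵥ u) (tgt' e', a)) - fun a => (Q *ᵥ u) (src' e', a)) ⬝ᵥ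
          ((R' e' *ᵥ fun a => (Q *ᵥ u) (tgt' e', a)) - fun a => (Q *ᵥ u) (src' e', a)) ≤
        A * ℓ * ∑ x, q (src' e') x * ∑ i ∈ range ℓ, F (γ e' x i) + Bk * ∑ x, q (src' e') x * M (σ e' x) := by
    intro e'
    rw [coarseDiff_avg_eq hQ (R' e') (σ e') (hσq e') u]
    refine (dotProduct_self_wsum_le' Finset.univ (fun x _ => hq _ x) (hq1 _) _).trans ?_
    calc ∑ x, q (src' e') x *
            (((R' e' *ᵥ (W (tgt' e') (σ e' x) *ᵥ fun b => u (σ e' x, b))) - W (src' e') x *ᵥ fun b => u (x, b)) ⬝ᵥ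
              ((R' e' *ᵥ (W (tgt' e') (σ e' x) *ᵥ fun b => u (σ e' x, b))) - W (src' e') x *ᵥ fun b => u (x, b)))
        ≤ ∑ x, q (src' e') x * (A * (ℓ * ∑ i ∈ range ℓ, F (γ e' x i)) + Bk * M (σ e' x)) :=
          Finset.sum_le_sum fun x _ => mul_le_mul_of_nonneg_left (hchain' e' x) (hq _ x)
      _ = A * ℓ * ∑ x, q (src' e') x * ∑ i ∈ range ℓ, F (γ e' x i) + Bk * ∑ x, q (src' e') x * M (σ e' x) := by
          rw [Finset.mul_sum, Finset.mul_sum, ← Finset.sum_add_distrib]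
          exact Finset.sum_congr rfl fun x _ => by ring
  -- sum over the coarse bonds
  have hsum : ∑ e', ((R' e' *ᵥ fun a => (Q *ᵥ u) (tgt' e', a)) - fun a => (Q *ᵥ u) (src' e', a)) ⬝ᵥ
          ((R' e' *ᵥ fun a => (Q *ᵥ u) (tgt' e', a)) - fun a => (Q *ᵥ u) (src' e', a)) ≤
        A * ℓ * ∑ e', ∑ x, q (src' e') x * ∑ i ∈ range ℓ, F (γ e' x i) + Bk * ∑ e', ∑ x, q (src' e') x * M (σ e' x) := by
    refine (Finset.sum_le_sum fun e' _ => hper e').trans (le_of_eq ?_)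
    rw [Finset.sum_add_distrib, ← Finset.mul_sum, ← Finset.mul_sum]
  -- the two counting sums
  have hmu := sum_chain_le_of_multiplicity q src' γ ℓ hmult F hF0
  have hgr := sum_pair_le_of_gramCount q src' tgt' σ hσq hgram M hM0
  have hMu : ∑ x, M x = u ⬝ᵥ u := (dotProduct_self_eq_sum_sites u).symm
  refine (hHc _).trans (mul_le_mul_of_nonneg_left (hsum.trans ?_) hwc)
  rw [← hMu]
  exact add_le_add (mul_le_mul_of_nonneg_left hmu (mul_nonneg hA (Nat.cast_nonneg _))) (mul_le_mul_of_nonneg_left hgr hBk)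

end Core

/-! ## §4 THE ENDS: flat loops ⟹ (STAB) with constant 1; loops flat up to κ ⟹ (STAB-ε,δ) -/

section Ends

variable {o μ ν β β' : Type*} [Fintype o] [DecidableEq o] [Fintype μ] [Fintype ν] [Fintype β] [DecidableEq β] [Fintype β']
variable {q : μ → ν → ℝ} {W : μ → ν → Matrix o o ℝ} {Q : Matrix (μ × o) (ν × o) ℝ}
variable {src tgt : β → ν} {R : β → Matrix o o ℝ} {src' tgt' : β' → μ} {R' : β' → Matrix o o ℝ}
variable {Hf : Matrix (ν × o) (ν × o) ℝ} {Hc : Matrix (μ × o) (μ × o) ℝ} {wf wc : ℝ}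
variable {σ : β' → ν ≃ ν} {ℓ : ℕ} {xs : β' → ν → ℕ → ν} {γ : β' → ν → ℕ → β} {T : β' → ν → ℕ → Matrix o o ℝ} {m g : ℝ}

/-- **`covJensen_flat` — FLAT LOOPS: THE COVARIANT JENSEN INEQUALITY WITH CONSTANT 1** [our proof].  Structure as in the module docstring; the loop
holonomies are trivial: `W(src′e′,x)ᵀ·R′_{e′}·W(tgt′e′,σx)·T_ℓ(e′,x)ᵀ = 1`.  Then `⟨Qu, H_c Qu⟩ ≤ w_c·ℓ·m·Σ_e |D_e u|²`, hence `≤ ⟨u, H_f u⟩` when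
`w_c·ℓ·m ≤ w_f`. -/
theorem covJensen_flat
    (hq : ∀ y x, 0 ≤ q y x) (hq1 : ∀ y, ∑ x, q y x ≤ 1) (hW : ∀ y x, (W y x)ᵀ * W y x = 1) (hR : ∀ e, (R e)ᵀ * R e = 1)
    (hQ : ∀ (u : ν × o → ℝ) (y : μ), (fun a => (Q *ᵥ u) (y, a)) = ∑ x, q y x • (W y x *ᵥ fun b => u (x, b)))
    (hwc : 0 ≤ wc)
    (hHc : ∀ v : μ × o → ℝ, v ⬝ᵥ (Hc *ᵥ v) ≤
      wc * ∑ e', ((R' e' *ᵥ fun a => v (tgt' e', a)) - fun a => v (src' e', a)) ⬝ᵥ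
        ((R' e' *ᵥ fun a => v (tgt' e', a)) - fun a => v (src' e', a)))
    (hHf : ∀ u : ν × o → ℝ, wf * ∑ e, ((R e *ᵥ fun b => u (tgt e, b)) - fun b => u (src e, b)) ⬝ᵥ
        ((R e *ᵥ fun b => u (tgt e, b)) - fun b => u (src e, b)) ≤ u ⬝ᵥ (Hf *ᵥ u))
    (hσq : ∀ e' x, q (tgt' e') (σ e' x) = q (src' e') x)
    (hx0 : ∀ e' x, xs e' x 0 = x) (hxℓ : ∀ e' x, xs e' x ℓ = σ e' x)
    (hsrc : ∀ e' x i, i < ℓ → src (γ e' x i) = xs e' x i) (htgt : ∀ e' x i, i < ℓ → tgt (γ e' x i) = xs e' x (i + 1))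
    (hT0 : ∀ e' x, T e' x 0 = 1) (hT : ∀ e' x i, i < ℓ → T e' x (i + 1) = T e' x i * R (γ e' x i))
    (hmult : ∀ e, ∑ e', ∑ x, ∑ i ∈ range ℓ, (if γ e' x i = e then q (src' e') x else 0) ≤ m)
    (hw : wc * ℓ * m ≤ wf)
    (hflat : ∀ e' x, (W (src' e') x)ᵀ * R' e' * W (tgt' e') (σ e' x) * (T e' x ℓ)ᵀ = 1) (u : ν × o → ℝ) :
    (Q *ᵥ u) ⬝ᵥ (Hc *ᵥ (Q *ᵥ u)) ≤ u ⬝ᵥ (Hf *ᵥ u) := by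
  have hgram : ∀ x, ∑ e', q (tgt' e') x ≤ ∑ x', ∑ e', q (tgt' e') x' := fun x =>
    Finset.single_le_sum (f := fun x' => ∑ e', q (tgt' e') x') (fun x' _ => Finset.sum_nonneg fun e' _ => hq _ _)
      (Finset.mem_univ x)
  have hcore := covJensen_core hq hq1 hQ hwc hHc hσq hmult hgram (A := 1) (Bk := 0) zero_le_one le_rfl u (fun e' x => by
    have hTl : (T e' x ℓ)ᵀ * T e' x ℓ = 1 :=
      orthogonal_partialTransport (R := fun i => R (γ e' x i)) (fun i _ => hR _) (hT0 e' x) (fun i hi => hT e' x i hi) ℓ le_rfl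
    rw [transported_pair_eq (hW (src' e') x) hTl, self_of_orthogonal (hW (src' e') x), hflat e' x, one_mulVec]
    have h := dotProduct_self_chain_le (R := fun i => R (γ e' x i)) (T := T e' x) (fun i _ => hR _) (hT0 e' x)
      (fun i hi => hT e' x i hi) (fun i => fun b => u (xs e' x i, b))
    rw [hxℓ, hx0] at h
    have hs : ∑ i ∈ range ℓ, ((R (γ e' x i) *ᵥ fun b => u (tgt (γ e' x i), b)) - fun b => u (src (γ e' x i), b)) ⬝ᵥ
          ((R (γ e' x i) *ᵥ fun b => u (tgt (γ e' x i), b)) - fun b => u (src (γ e' x i), b)) =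
        ∑ i ∈ range ℓ, ((R (γ e' x i) *ᵥ fun b => u (xs e' x (i + 1), b)) - fun b => u (xs e' x i, b)) ⬝ᵥ
          ((R (γ e' x i) *ᵥ fun b => u (xs e' x (i + 1), b)) - fun b => u (xs e' x i, b)) :=
      Finset.sum_congr rfl fun i hi => by rw [hsrc e' x i (mem_range.mp hi), htgt e' x i (mem_range.mp hi)]
    rw [hs]
    refine h.trans (le_of_eq ?_)
    ring)
  have hF0 : 0 ≤ ∑ e, ((R e *ᵥ fun b => u (tgt e, b)) - fun b => u (src e, b)) ⬝ᵥ
      ((R e *ᵥ fun b => u (tgt e, b)) - fun b => u (src e, b)) := Finset.sum_nonneg fun e _ => dotProduct_self_nonneg' _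
  refine hcore.trans ?_
  refine le_trans ?_ (hHf u)
  nlinarith [mul_le_mul_of_nonneg_right hw hF0]

/-- **`posSemidef_covJensen_flat` — (STAB) WITH CONSTANT EXACTLY 1, AS THE LOEWNER INEQUALITY PART 18 CONSUMES**: under the hypotheses of
`covJensen_flat` with `H_f`, `H_c` symmetric: `(H_f − Qᵀ H_c Q).PosSemidef`. [our proof] -/
theorem posSemidef_covJensen_flat
    (hq : ∀ y x, 0 ≤ q y x) (hq1 : ∀ y, ∑ x, q y x ≤ 1) (hW : ∀ y x, (W y x)ᵀ * W y x = 1) (hR : ∀ e, (R e)ᵀ * R e = 1)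
    (hQ : ∀ (u : ν × o → ℝ) (y : μ), (fun a => (Q *ᵥ u) (y, a)) = ∑ x, q y x • (W y x *ᵥ fun b => u (x, b)))
    (hwc : 0 ≤ wc) (hHfs : Hfᵀ = Hf) (hHcs : Hcᵀ = Hc)
    (hHc : ∀ v : μ × o → ℝ, v ⬝ᵥ (Hc *ᵥ v) ≤
      wc * ∑ e', ((R' e' *ᵥ fun a => v (tgt' e', a)) - fun a => v (src' e', a)) ⬝ᵥ
        ((R' e' *ᵥ fun a => v (tgt' e', a)) - fun a => v (src' e', a)))
    (hHf : ∀ u : ν × o → ℝ, wf * ∑ e, ((R e *ᵥ fun b => u (tgt e, b)) - fun b => u (src e, b)) ⬝ᵥ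
        ((R e *ᵥ fun b => u (tgt e, b)) - fun b => u (src e, b)) ≤ u ⬝ᵥ (Hf *ᵥ u))
    (hσq : ∀ e' x, q (tgt' e') (σ e' x) = q (src' e') x)
    (hx0 : ∀ e' x, xs e' x 0 = x) (hxℓ : ∀ e' x, xs e' x ℓ = σ e' x)
    (hsrc : ∀ e' x i, i < ℓ → src (γ e' x i) = xs e' x i) (htgt : ∀ e' x i, i < ℓ → tgt (γ e' x i) = xs e' x (i + 1))
    (hT0 : ∀ e' x, T e' x 0 = 1) (hT : ∀ e' x i, i < ℓ → T e' x (i + 1) = T e' x i * R (γ e' x i))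
    (hmult : ∀ e, ∑ e', ∑ x, ∑ i ∈ range ℓ, (if γ e' x i = e then q (src' e') x else 0) ≤ m)
    (hw : wc * ℓ * m ≤ wf)
    (hflat : ∀ e' x, (W (src' e') x)ᵀ * R' e' * W (tgt' e') (σ e' x) * (T e' x ℓ)ᵀ = 1) :
    (Hf - Qᵀ * Hc * Q).PosSemidef := by
  refine PosSemidef.of_dotProduct_mulVec_nonneg ?_ fun u => ?_
  · rw [Matrix.IsHermitian, Matrix.conjTranspose_eq_transpose_of_trivial, transpose_sub, hHfs, transpose_mul, transpose_mul,
      transpose_transpose, hHcs, Matrix.mul_assoc]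
  · simp only [star_trivial, sub_mulVec, dotProduct_sub, sub_nonneg]
    have e : u ⬝ᵥ ((Qᵀ * Hc * Q) *ᵥ u) = (Q *ᵥ u) ⬝ᵥ (Hc *ᵥ (Q *ᵥ u)) := by
      rw [mulVec_dotProduct_eq, mulVec_mulVec, mulVec_mulVec, Matrix.mul_assoc]
    rw [e]
    exact covJensen_flat hq hq1 hW hR hQ hwc hHc hHf hσq hx0 hxℓ hsrc htgt hT0 hT hmult hw hflat u

/-- **`covJensen_holonomy` — LOOPS FLAT UP TO κ: THE COVARIANT JENSEN INEQUALITY WITH A PETER–PAUL SPLIT** [our proof].  Structure as in the module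
docstring; the loop holonomies `V = W(src′e′,x)ᵀ·R′_{e′}·W(tgt′e′,σx)·T_ℓ(e′,x)ᵀ` satisfy `|(V − 1)w|² ≤ κ²|w|²`.  Then for every `t > 0`:
`⟨Qu, H_c Qu⟩ ≤ (1+t)·⟨u, H_f u⟩ + (1+t⁻¹)·κ²·w_c·g·|u|²`. -/
theorem covJensen_holonomy
    (hq : ∀ y x, 0 ≤ q y x) (hq1 : ∀ y, ∑ x, q y x ≤ 1) (hW : ∀ y x, (W y x)ᵀ * W y x = 1) (hR : ∀ e, (R e)ᵀ * R e = 1)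
    (hQ : ∀ (u : ν × o → ℝ) (y : μ), (fun a => (Q *ᵥ u) (y, a)) = ∑ x, q y x • (W y x *ᵥ fun b => u (x, b)))
    (hwc : 0 ≤ wc)
    (hHc : ∀ v : μ × o → ℝ, v ⬝ᵥ (Hc *ᵥ v) ≤
      wc * ∑ e', ((R' e' *ᵥ fun a => v (tgt' e', a)) - fun a => v (src' e', a)) ⬝ᵥ
        ((R' e' *ᵥ fun a => v (tgt' e', a)) - fun a => v (src' e', a)))
    (hHf : ∀ u : ν × o → ℝ, wf * ∑ e, ((R e *ᵥ fun b => u (tgt e, b)) - fun b => u (src e, b)) ⬝ᵥ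
        ((R e *ᵥ fun b => u (tgt e, b)) - fun b => u (src e, b)) ≤ u ⬝ᵥ (Hf *ᵥ u))
    (hσq : ∀ e' x, q (tgt' e') (σ e' x) = q (src' e') x)
    (hx0 : ∀ e' x, xs e' x 0 = x) (hxℓ : ∀ e' x, xs e' x ℓ = σ e' x)
    (hsrc : ∀ e' x i, i < ℓ → src (γ e' x i) = xs e' x i) (htgt : ∀ e' x i, i < ℓ → tgt (γ e' x i) = xs e' x (i + 1))
    (hT0 : ∀ e' x, T e' x 0 = 1) (hT : ∀ e' x i, i < ℓ → T e' x (i + 1) = T e' x i * R (γ e' x i))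
    (hmult : ∀ e, ∑ e', ∑ x, ∑ i ∈ range ℓ, (if γ e' x i = e then q (src' e') x else 0) ≤ m)
    (hgram : ∀ x, ∑ e', q (tgt' e') x ≤ g) (hw : wc * ℓ * m ≤ wf) {κ : ℝ}
    (hV : ∀ e' x (w : o → ℝ),
      (((W (src' e') x)ᵀ * R' e' * W (tgt' e') (σ e' x) * (T e' x ℓ)ᵀ - 1) *ᵥ w) ⬝ᵥ
          (((W (src' e') x)ᵀ * R' e' * W (tgt' e') (σ e' x) * (T e' x ℓ)ᵀ - 1) *ᵥ w) ≤ κ ^ 2 * (w ⬝ᵥ w))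
    {t : ℝ} (ht : 0 < t) (u : ν × o → ℝ) :
    (Q *ᵥ u) ⬝ᵥ (Hc *ᵥ (Q *ᵥ u)) ≤ (1 + t) * (u ⬝ᵥ (Hf *ᵥ u)) + (1 + t⁻¹) * κ ^ 2 * wc * g * (u ⬝ᵥ u) := by
  have hA : (0 : ℝ) ≤ 1 + t := by linarith
  have hBk : (0 : ℝ) ≤ (1 + t⁻¹) * κ ^ 2 := by positivity
  have hcore := covJensen_core hq hq1 hQ hwc hHc hσq hmult hgram hA hBk u (fun e' x => by
    have hTl : (T e' x ℓ)ᵀ * T e' x ℓ = 1 :=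
      orthogonal_partialTransport (R := fun i => R (γ e' x i)) (fun i _ => hR _) (hT0 e' x) (fun i hi => hT e' x i hi) ℓ le_rfl
    rw [transported_pair_eq (hW (src' e') x) hTl, self_of_orthogonal (hW (src' e') x)]
    have h := dotProduct_self_holonomy_chain_le (R := fun i => R (γ e' x i)) (T := T e' x) (fun i _ => hR _) (hT0 e' x)
      (fun i hi => hT e' x i hi) (hV e' x) ht (fun i => fun b => u (xs e' x i, b))
    rw [hxℓ, hx0] at h
    have hs : ∑ i ∈ range ℓ, ((R (γ e' x i) *ᵥ fun b => u (tgt (γ e' x i), b)) - fun b => u (src (γ e' x i), b)) ⬝ᵥ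
          ((R (γ e' x i) *ᵥ fun b => u (tgt (γ e' x i), b)) - fun b => u (src (γ e' x i), b)) =
        ∑ i ∈ range ℓ, ((R (γ e' x i) *ᵥ fun b => u (xs e' x (i + 1), b)) - fun b => u (xs e' x i, b)) ⬝ᵥ
          ((R (γ e' x i) *ᵥ fun b => u (xs e' x (i + 1), b)) - fun b => u (xs e' x i, b)) :=
      Finset.sum_congr rfl fun i hi => by rw [hsrc e' x i (mem_range.mp hi), htgt e' x i (mem_range.mp hi)]
    rw [hs]
    refine h.trans (le_of_eq ?_)
    ring)
  have hF0 : 0 ≤ ∑ e, ((R e *ᵥ fun b => u (tgt e, b)) - fun b => u (src e, b)) ⬝ᵥ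
      ((R e *ᵥ fun b => u (tgt e, b)) - fun b => u (src e, b)) := Finset.sum_nonneg fun e _ => dotProduct_self_nonneg' _
  have huu : 0 ≤ u ⬝ᵥ u := dotProduct_self_nonneg' _
  refine hcore.trans ?_
  have h1 : wc * ((1 + t) * ℓ * (m * ∑ e, ((R e *ᵥ fun b => u (tgt e, b)) - fun b => u (src e, b)) ⬝ᵥ
        ((R e *ᵥ fun b => u (tgt e, b)) - fun b => u (src e, b)))) ≤ (1 + t) * (u ⬝ᵥ (Hf *ᵥ u)) := by
    have := mul_le_mul_of_nonneg_right hw hF0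
    nlinarith [hHf u, mul_le_mul_of_nonneg_left (this.trans (hHf u)) hA]
  have h2 : wc * ((1 + t⁻¹) * κ ^ 2 * (g * (u ⬝ᵥ u))) = (1 + t⁻¹) * κ ^ 2 * wc * g * (u ⬝ᵥ u) := by ring
  rw [mul_add, h2]
  exact add_le_add h1 le_rfl

/-- **`posSemidef_covJensen_holonomy` — (STAB-ε,δ) AS THE LOEWNER INEQUALITY PART 20 CONSUMES** (`G = 1`): under the hypotheses of
`covJensen_holonomy` with `H_f`, `H_c` symmetric, for every `t > 0`:
`((1 + t)•H_f + ((1 + t⁻¹)·κ²·w_c·g)•1 − Qᵀ H_c Q).PosSemidef`. [our proof] -/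
theorem posSemidef_covJensen_holonomy [DecidableEq ν]
    (hq : ∀ y x, 0 ≤ q y x) (hq1 : ∀ y, ∑ x, q y x ≤ 1) (hW : ∀ y x, (W y x)ᵀ * W y x = 1) (hR : ∀ e, (R e)ᵀ * R e = 1)
    (hQ : ∀ (u : ν × o → ℝ) (y : μ), (fun a => (Q *ᵥ u) (y, a)) = ∑ x, q y x • (W y x *ᵥ fun b => u (x, b)))
    (hwc : 0 ≤ wc) (hHfs : Hfᵀ = Hf) (hHcs : Hcᵀ = Hc)
    (hHc : ∀ v : μ × o → ℝ, v ⬝ᵥ (Hc *ᵥ v) ≤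
      wc * ∑ e', ((R' e' *ᵥ fun a => v (tgt' e', a)) - fun a => v (src' e', a)) ⬝ᵥ
        ((R' e' *ᵥ fun a => v (tgt' e', a)) - fun a => v (src' e', a)))
    (hHf : ∀ u : ν × o → ℝ, wf * ∑ e, ((R e *ᵥ fun b => u (tgt e, b)) - fun b => u (src e, b)) ⬝ᵥ
        ((R e *ᵥ fun b => u (tgt e, b)) - fun b => u (src e, b)) ≤ u ⬝ᵥ (Hf *ᵥ u))
    (hσq : ∀ e' x, q (tgt' e') (σ e' x) = q (src' e') x)
    (hx0 : ∀ e' x, xs e' x 0 = x) (hxℓ : ∀ e' x, xs e' x ℓ = σ e' x)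
    (hsrc : ∀ e' x i, i < ℓ → src (γ e' x i) = xs e' x i) (htgt : ∀ e' x i, i < ℓ → tgt (γ e' x i) = xs e' x (i + 1))
    (hT0 : ∀ e' x, T e' x 0 = 1) (hT : ∀ e' x i, i < ℓ → T e' x (i + 1) = T e' x i * R (γ e' x i))
    (hmult : ∀ e, ∑ e', ∑ x, ∑ i ∈ range ℓ, (if γ e' x i = e then q (src' e') x else 0) ≤ m)
    (hgram : ∀ x, ∑ e', q (tgt' e') x ≤ g) (hw : wc * ℓ * m ≤ wf) {κ : ℝ}
    (hV : ∀ e' x (w : o → ℝ),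
      (((W (src' e') x)ᵀ * R' e' * W (tgt' e') (σ e' x) * (T e' x ℓ)ᵀ - 1) *ᵥ w) ⬝ᵥ
          (((W (src' e') x)ᵀ * R' e' * W (tgt' e') (σ e' x) * (T e' x ℓ)ᵀ - 1) *ᵥ w) ≤ κ ^ 2 * (w ⬝ᵥ w))
    {t : ℝ} (ht : 0 < t) :
    ((1 + t) • Hf + ((1 + t⁻¹) * κ ^ 2 * wc * g) • (1 : Matrix (ν × o) (ν × o) ℝ) - Qᵀ * Hc * Q).PosSemidef := by
  refine PosSemidef.of_dotProduct_mulVec_nonneg ?_ fun u => ?_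
  · rw [Matrix.IsHermitian, Matrix.conjTranspose_eq_transpose_of_trivial, transpose_sub, transpose_add, transpose_smul, transpose_smul,
      transpose_one, hHfs, transpose_mul, transpose_mul, transpose_transpose, hHcs, Matrix.mul_assoc]
  · simp only [star_trivial, sub_mulVec, add_mulVec, dotProduct_sub, dotProduct_add, smul_mulVec, dotProduct_smul, smul_eq_mul,
      one_mulVec, sub_nonneg]
    have e : u ⬝ᵥ ((Qᵀ * Hc * Q) *ᵥ u) = (Q *ᵥ u) ⬝ᵥ (Hc *ᵥ (Q *ᵥ u)) := by
      rw [mulVec_dotProduct_eq, mulVec_mulVec, mulVec_mulVec, Matrix.mul_assoc]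
    rw [e]
    exact covJensen_holonomy hq hq1 hW hR hQ hwc hHc hHf hσq hx0 hxℓ hsrc htgt hT0 hT hmult hgram hw hV ht u

end Ends

end Summit.QuantumFields.BalabanUV.Beta.GAN24.DerivativeRateTransferJensen

end
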